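import Mathlib.Data.Matrix.Composition
import Mathlib.Data.Matrix.Block
import Mathlib.LinearAlgebra.Matrix.NonsingularInverse
import Mathlib.Algebra.Ring.GeomSum
import Mathlib.Tactic.NoncommRing
import HarnessLib

/-!
# Linearisation of polynomial clutching matrices (Husemöller, *Fibre Bundles*, Ch. 11 §3): block algebra

The purely algebraic part of the linearisation step in the Atiyah–Bott proof of complex Bott
periodicity. Over a commutative ring `S` with distinguished elements `z` ("the coordinate on
`S¹`") and `t` ("the homotopy parameter"), for coefficients `a₀, …, a_m ∈ M_ι(S)` of a polynomial
clutching matrix `p(z) = ∑ zᵏ aₖ` (`polyEval`), with tails `p_r^*(z) = ∑_{k ≥ r} z^{k-r} aₖ`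
(`polyTail`, `p_r^* - z p_{r+1}^* = a_r`), we consider `(m+1) × (m+1)` block matrices
(`Blk m ι S = Matrix (Fin (m+1)) (Fin (m+1)) (M_ι(S))`):

* `Dmat = diag(p, 1, …, 1)`, `N1` = first row `(0, p₁^*, …, p_m^*)`, `N2` = subdiagonal `-z`,
  the homotopy `Lt a z t = (1 + t N₁) D (1 + t N₂)` and the **linear clutching matrix**
  `Lmat` = `Lᵐ(p)` (first row `a₀ … a_m`, `1` on the diagonal, `-z` below it);
* **`Lt_one : Lt a z 1 = Lmat a z`** — the factorisation `Lᵐ(p) = (1 + N₁)(p ⊕ 1_m)(1 + N₂)` of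
  Husemöller 11 (3.1); `Lt_zero : Lt a z 0 = Dmat a z`;
* invertibility: `N1_mul_N1 = 0`, `N2_pow_eq_zero : N₂^{m+1} = 0`, the explicit inverse
  `LtInv = (∑ⱼ (-tN₂)ʲ) D⁻¹ (1 - tN₁)` with `Lt_mul_LtInv`, `LtInv_mul_Lt` (given an inverse of `p(z)`);
* linearity `Lmat_eq : Lmat a z = LmatA a + z • LmatB`, and compatibility with ring changes
  (`Lt_map`, `comp_Lt_map`; entry level via `Matrix.comp`).

This is used with `S = C(X × S¹, ℂ)` (resp. `C((X × [0,1]) × S¹, ℂ)`) to show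
`[Lᵐ(θ), Lᵐ(p)] = [θ, p] + m [θ, 1]` (Husemöller 11 Prop. 3.2). Everything is proved; no named facts.

## References

* D. Husemöller, *Fibre Bundles*, 3rd ed. (1994) [HusemollerFibreBundles1994]: Ch. 11 §3,
  Notation 3.1, Prop. 3.2.
-/

namespace Literature.AlgebraicTopology.KTheory.Linearization

open Matrix Finset

variable {S : Type*} [CommRing S] {ι : Type*} [Fintype ι] [DecidableEq ι] {m : ℕ}

/-- `p(z) = ∑ₖ zᵏ aₖ`. [cite: HusemollerFibreBundles1994, Ch. 11 Notation 3.1] -/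
def polyEval (a : Fin (m + 1) → Matrix ι ι S) (z : S) : Matrix ι ι S := ∑ k : Fin (m + 1), z ^ (k : ℕ) • a k

/-- The tails `p_r^*(z) = ∑_{k ≥ r} z^{k-r} aₖ`. [cite: HusemollerFibreBundles1994, Ch. 11 Notation 3.1] -/
def polyTail (a : Fin (m + 1) → Matrix ι ι S) (z : S) (r : Fin (m + 1)) : Matrix ι ι S :=
  ∑ k : Fin (m + 1), if r ≤ k then z ^ ((k : ℕ) - r) • a k else 0

omit [Fintype ι] [DecidableEq ι] in
/-- Auxiliary identity for the linearisation block algebra. [folklore] -/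
theorem polyTail_zero (a : Fin (m + 1) → Matrix ι ι S) (z : S) : polyTail a z 0 = polyEval a z := by
  simp [polyTail, polyEval]

omit [Fintype ι] [DecidableEq ι] in
/-- Auxiliary identity for the linearisation block algebra. [folklore] -/
theorem polyTail_last (a : Fin (m + 1) → Matrix ι ι S) (z : S) : polyTail a z (Fin.last m) = a (Fin.last m) := by
  rw [polyTail, Finset.sum_eq_single (Fin.last m)]
  · simp
  · intro k _ hk
    rw [if_neg]
    exact fun h ↦ hk (le_antisymm (Fin.le_last k) h)
  · simp

omit [Fintype ι] [DecidableEq ι] in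
/-- `p_r^* - z p_{r+1}^* = a_r`. [cite: HusemollerFibreBundles1994, Ch. 11 Notation 3.1] -/
theorem polyTail_sub (a : Fin (m + 1) → Matrix ι ι S) (z : S) (r : Fin (m + 1)) (hr : (r : ℕ) + 1 < m + 1) :
    polyTail a z r - z • polyTail a z ⟨r + 1, hr⟩ = a r := by
  simp only [polyTail, Finset.smul_sum, ← Finset.sum_sub_distrib]
  rw [Finset.sum_eq_single r]
  · simp [Fin.le_def]
  · intro k _ hk
    by_cases h1 : r ≤ k
    · have h2 : (⟨r + 1, hr⟩ : Fin (m + 1)) ≤ k := by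
        rw [Fin.le_def] at h1 ⊢
        have : (r : ℕ) ≠ k := fun h ↦ hk (Fin.ext h).symm
        simp only; omega
      rw [if_pos h1, if_pos h2, smul_smul, ← pow_succ']
      have : (k : ℕ) - (r + 1) + 1 = (k : ℕ) - r := by
        rw [Fin.le_def] at h2; simp only at h2; omega
      simp only [this, sub_self]
    · have h2 : ¬ (⟨r + 1, hr⟩ : Fin (m + 1)) ≤ k := by
        rw [Fin.le_def] at h1 ⊢; simp only; omega
      rw [if_neg h1, if_neg h2, smul_zero, sub_zero]
  · simp [Fin.le_def]

/-! ### The block matrices -/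

/-- Block matrices `(m+1) × (m+1)` with entries in `M_ι(S)`. [cite: HusemollerFibreBundles1994, Ch. 11 Notation 3.1] -/
abbrev Blk (m : ℕ) (ι : Type*) (S : Type*) : Type _ := Matrix (Fin (m + 1)) (Fin (m + 1)) (Matrix ι ι S)

/-- `D = diag(p, 1, …, 1)`. [cite: HusemollerFibreBundles1994, Ch. 11 Notation 3.1] -/
def Dmat (a : Fin (m + 1) → Matrix ι ι S) (z : S) : Blk m ι S :=
  Matrix.diagonal fun r ↦ if r = 0 then polyEval a z else 1

/-- `N₁` = first row `(0, p₁^*, …, p_m^*)`. [cite: HusemollerFibreBundles1994, Ch. 11 Notation 3.1] -/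
def N1 (a : Fin (m + 1) → Matrix ι ι S) (z : S) : Blk m ι S :=
  Matrix.of fun r c ↦ if r = 0 ∧ c ≠ 0 then polyTail a z c else 0

/-- `N₂` = subdiagonal `-z`. [cite: HusemollerFibreBundles1994, Ch. 11 Notation 3.1] -/
def N2 (z : S) : Blk m ι S :=
  Matrix.of fun r c ↦ if (c : ℕ) + 1 = r then -(z • (1 : Matrix ι ι S)) else 0

/-- The homotopy `L_t = (1 + t N₁) D (1 + t N₂)`. [cite: HusemollerFibreBundles1994, Ch. 11 Notation 3.1] -/
def Lt (a : Fin (m + 1) → Matrix ι ι S) (z t : S) : Blk m ι S :=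
  (1 + t • N1 a z) * Dmat a z * (1 + t • N2 z)

/-- **The linear clutching matrix `Lᵐ(p)`**: first row `(a₀, …, a_m)`, `1` on the diagonal and `-z`
on the subdiagonal below. [cite: HusemollerFibreBundles1994, Ch. 11 Notation 3.1] -/
def Lmat (a : Fin (m + 1) → Matrix ι ι S) (z : S) : Blk m ι S :=
  Matrix.of fun r c ↦ if r = 0 then a c else if c = r then 1 else if (c : ℕ) + 1 = r then -(z • (1 : Matrix ι ι S)) else 0

/-- Auxiliary identity for the linearisation block algebra. [folklore] -/
theorem Lt_zero (a : Fin (m + 1) → Matrix ι ι S) (z : S) : Lt a z 0 = Dmat a z := by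
  simp [Lt]

/-- `(1 + N₁) D` has first row `(p₀^*, p₁^*, …)` and the identity below. [folklore] -/
theorem one_add_N1_mul_Dmat (a : Fin (m + 1) → Matrix ι ι S) (z t : S) :
    (1 + t • N1 a z) * Dmat a z =
      Matrix.of fun r c ↦ if r = 0 then (if c = 0 then polyEval a z else t • polyTail a z c) else if c = r then 1 else 0 := by
  ext r c : 1
  rw [Dmat, Matrix.mul_diagonal, Matrix.add_apply, Matrix.one_apply, Matrix.smul_apply, N1, Matrix.of_apply, Matrix.of_apply]
  by_cases hr : r = 0
  · subst hr
    by_cases hc : c = 0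
    · subst hc; simp
    · simp [hc, Ne.symm hc]
  · by_cases hc : r = c
    · subst hc; simp [hr]
    · simp [hr, hc, Ne.symm hc]

omit [Fintype ι] in
/-- Auxiliary identity for the linearisation block algebra. [folklore] -/
theorem one_add_N2_apply (z t : S) (l c : Fin (m + 1)) :
    (1 + t • N2 z : Blk m ι S) l c = if l = c then 1 else if (c : ℕ) + 1 = l then -((t * z) • (1 : Matrix ι ι S)) else 0 := by
  rw [Matrix.add_apply, Matrix.one_apply, Matrix.smul_apply, N2, Matrix.of_apply]
  by_cases h : l = c
  · subst h; simp
  · by_cases h' : (c : ℕ) + 1 = l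
    · simp [h, h', smul_smul]
    · simp [h, h']

/-- Entries of `L_t`: first row `p_c^† - t z p_{c+1}^†` (`p_0^† = p`, `p_c^† = t p_c^*`), identity
diagonal and `-t z` subdiagonal below. [folklore] -/
theorem Lt_apply (a : Fin (m + 1) → Matrix ι ι S) (z t : S) (r c : Fin (m + 1)) :
    Lt a z t r c =
      (if r = 0 then (if c = 0 then polyEval a z else t • polyTail a z c) else if c = r then 1 else 0) +
        (if hc : (c : ℕ) + 1 < m + 1 then
          (if r = 0 then t • polyTail a z ⟨c + 1, hc⟩ else if (⟨c + 1, hc⟩ : Fin (m + 1)) = r then 1 else 0) * -((t * z) • 1)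
         else 0) := by
  rw [Lt, one_add_N1_mul_Dmat, Matrix.mul_apply]
  simp_rw [one_add_N2_apply]
  by_cases hc : (c : ℕ) + 1 < m + 1
  · set c' : Fin (m + 1) := ⟨c + 1, hc⟩ with hc'def
    have hcc' : c ≠ c' := by intro h; have := congrArg Fin.val h; simp [c'] at this
    have hc'0 : c' ≠ 0 := by intro h; have := congrArg Fin.val h; simp [c'] at this
    rw [Fintype.sum_eq_add c c' hcc']
    · rw [dif_pos hc, Matrix.of_apply, Matrix.of_apply]
      simp only [if_true, mul_one, hc'0, if_false, Ne.symm hcc']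
      simp [c']
    · rintro l ⟨hl, hl'⟩
      have : ¬ ((c : ℕ) + 1 = l) := fun h ↦ hl' (Fin.ext (by simp [c', h]))
      simp [hl, this]
  · rw [Finset.sum_eq_single c]
    · rw [dif_neg hc, Matrix.of_apply]; simp
    · intro l _ hl
      have : ¬ ((c : ℕ) + 1 = l) := fun h ↦ hc (h ▸ l.2)
      simp [hl, this]
    · simp

/-- **`L₁ = Lᵐ(p)`**: the factorisation `Lᵐ(p) = (1 + N₁)(p ⊕ 1)(1 + N₂)`. [cite: HusemollerFibreBundles1994, Ch. 11 Notation 3.1] -/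
theorem Lt_one (a : Fin (m + 1) → Matrix ι ι S) (z : S) : Lt a z 1 = Lmat a z := by
  ext r c : 1
  rw [Lt_apply, Lmat, Matrix.of_apply]
  simp only [one_smul, one_mul]
  by_cases hr : r = 0
  · subst hr
    simp only [if_true]
    have e1 : (if c = 0 then polyEval a z else polyTail a z c) = polyTail a z c := by
      split_ifs with h
      · rw [h, polyTail_zero]
      · rfl
    rw [e1]
    by_cases hc : (c : ℕ) + 1 < m + 1
    · rw [dif_pos hc]
      have e2 := Matrix.mul_smul (polyTail a z ⟨c + 1, hc⟩) z (1 : Matrix ι ι S)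
      rw [Matrix.mul_neg, e2, Matrix.mul_one, ← sub_eq_add_neg, polyTail_sub a z c hc]
    · rw [dif_neg hc, add_zero]
      have hcl : c = Fin.last m := Fin.ext (by simp [Fin.val_last]; omega)
      rw [hcl, polyTail_last]
  · simp only [hr, if_false]
    by_cases hc : (c : ℕ) + 1 < m + 1
    · rw [dif_pos hc]
      by_cases hcr : c = r
      · subst hcr
        have : (⟨(c : ℕ) + 1, hc⟩ : Fin (m + 1)) ≠ c := by intro h; have := congrArg Fin.val h; simp at this
        simp [this]
      · rw [if_neg hcr]
        by_cases hc'r : (⟨(c : ℕ) + 1, hc⟩ : Fin (m + 1)) = r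
        · have h2 : (c : ℕ) + 1 = r := by rw [← hc'r]
          simp [h2, hcr]
        · have h2 : ¬ ((c : ℕ) + 1 = r) := fun h ↦ hc'r (Fin.ext h)
          simp [hc'r, h2, hcr]
    · rw [dif_neg hc, add_zero]
      by_cases hcr : c = r
      · simp [hcr]
      · have h2 : ¬ ((c : ℕ) + 1 = r) := fun h ↦ hc (h ▸ r.2)
        simp [hcr, h2]

/-! ### Invertibility of `L_t` -/

omit [Fintype ι] [DecidableEq ι] in
/-- `N₁² = 0`. [folklore] -/
theorem N1_mul_N1 [Fintype ι] (a : Fin (m + 1) → Matrix ι ι S) (z : S) : N1 a z * N1 a z = 0 := by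
  ext r c : 1
  rw [Matrix.mul_apply, Matrix.zero_apply]
  refine Finset.sum_eq_zero fun l _ ↦ ?_
  simp only [N1, Matrix.of_apply]
  by_cases hl : l = 0
  · simp [hl]
  · simp [hl]

/-- Powers of the subdiagonal: `(N₂ʲ)_{rc} ≠ 0` only for `r = c + j`. [folklore] -/
theorem N2_pow_apply (z : S) (j : ℕ) (r c : Fin (m + 1)) :
    (N2 z ^ j : Blk m ι S) r c = if (c : ℕ) + j = r then (-(z • (1 : Matrix ι ι S))) ^ j else 0 := by
  induction j generalizing r c with
  | zero => simp [Matrix.one_apply, eq_comm, Fin.ext_iff]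
  | succ j ih =>
    rw [pow_succ, Matrix.mul_apply]
    by_cases h : (c : ℕ) + (j + 1) = r
    · rw [if_pos h]
      have hc : (c : ℕ) + 1 < m + 1 := by have := r.2; omega
      rw [Finset.sum_eq_single (⟨c + 1, hc⟩ : Fin (m + 1))]
      · rw [ih, N2, Matrix.of_apply, if_pos (by simp; omega), if_pos rfl, pow_succ]
      · intro l _ hl
        rw [N2, Matrix.of_apply, if_neg (fun h' ↦ hl (Fin.ext (by simp; omega))), mul_zero]
      · simp
    · rw [if_neg h]
      refine Finset.sum_eq_zero fun l _ ↦ ?_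
      rw [ih, N2, Matrix.of_apply]
      by_cases h1 : (c : ℕ) + 1 = l
      · rw [if_neg (fun h2 ↦ h (by omega)), zero_mul]
      · rw [if_neg h1, mul_zero]

/-- `N₂^{m+1} = 0`. [folklore] -/
theorem N2_pow_eq_zero (z : S) : (N2 z ^ (m + 1) : Blk m ι S) = 0 := by
  ext r c : 1
  rw [N2_pow_apply, Matrix.zero_apply, if_neg]
  have := r.2; omega

/-- The inverse `1 - t N₁` of `1 + t N₁`. [folklore] -/
theorem smul_N1_mul_smul_N1 (a : Fin (m + 1) → Matrix ι ι S) (z t : S) : (t • N1 a z) * (t • N1 a z) = 0 := by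
  have e1 := Matrix.smul_mul t (N1 a z) (t • N1 a z)
  have e2 := Matrix.mul_smul (N1 a z) t (N1 a z)
  rw [e1, e2, N1_mul_N1, smul_zero, smul_zero]

/-- Auxiliary identity for the linearisation block algebra. [folklore] -/
theorem one_add_N1_mul (a : Fin (m + 1) → Matrix ι ι S) (z t : S) : (1 + t • N1 a z) * (1 - t • N1 a z) = 1 := by
  have h := smul_N1_mul_smul_N1 a z t
  set X := t • N1 a z
  calc (1 + X) * (1 - X) = 1 - X * X := by noncomm_ring
    _ = 1 := by rw [h, sub_zero]

/-- Auxiliary identity for the linearisation block algebra. [folklore] -/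
theorem one_sub_N1_mul (a : Fin (m + 1) → Matrix ι ι S) (z t : S) : (1 - t • N1 a z) * (1 + t • N1 a z) = 1 := by
  have h := smul_N1_mul_smul_N1 a z t
  set X := t • N1 a z
  calc (1 - X) * (1 + X) = 1 - X * X := by noncomm_ring
    _ = 1 := by rw [h, sub_zero]

/-- The inverse `∑ⱼ (-t N₂)ʲ` of `1 + t N₂`. [folklore] -/
def N2Inv (z t : S) : Blk m ι S := ∑ j ∈ Finset.range (m + 1), (-(t • N2 z)) ^ j

/-- Auxiliary identity for the linearisation block algebra. [folklore] -/
theorem neg_smul_N2_pow (z t : S) : (-(t • N2 z) : Blk m ι S) ^ (m + 1) = 0 := by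
  rw [neg_pow, smul_pow, N2_pow_eq_zero, smul_zero, mul_zero]

/-- Auxiliary identity for the linearisation block algebra. [folklore] -/
theorem one_add_N2_mul_N2Inv (z t : S) : (1 + t • N2 z) * N2Inv z t = (1 : Blk m ι S) := by
  have h := mul_neg_geom_sum (-(t • N2 z) : Blk m ι S) (m + 1)
  rw [sub_neg_eq_add, neg_smul_N2_pow, sub_zero] at h
  exact h

/-- Auxiliary identity for the linearisation block algebra. [folklore] -/
theorem N2Inv_mul_one_add_N2 (z t : S) : N2Inv z t * (1 + t • N2 z) = (1 : Blk m ι S) := by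
  have h := geom_sum_mul_neg (-(t • N2 z) : Blk m ι S) (m + 1)
  rw [sub_neg_eq_add, neg_smul_N2_pow, sub_zero] at h
  exact h

/-- The inverse of `D = diag(p, 1, …, 1)`. [folklore] -/
def DmatInv (pinv : Matrix ι ι S) : Blk m ι S := Matrix.diagonal fun r ↦ if r = 0 then pinv else 1

/-- Auxiliary identity for the linearisation block algebra. [folklore] -/
theorem Dmat_mul_DmatInv (a : Fin (m + 1) → Matrix ι ι S) (z : S) {pinv : Matrix ι ι S} (h : polyEval a z * pinv = 1) :
    Dmat a z * DmatInv pinv = 1 := by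
  rw [Dmat, DmatInv, Matrix.diagonal_mul_diagonal, ← Matrix.diagonal_one]
  congr 1; ext r : 1
  by_cases hr : r = 0 <;> simp [hr, h]

/-- Auxiliary identity for the linearisation block algebra. [folklore] -/
theorem DmatInv_mul_Dmat (a : Fin (m + 1) → Matrix ι ι S) (z : S) {pinv : Matrix ι ι S} (h : pinv * polyEval a z = 1) :
    DmatInv pinv * Dmat a z = 1 := by
  rw [Dmat, DmatInv, Matrix.diagonal_mul_diagonal, ← Matrix.diagonal_one]
  congr 1; ext r : 1
  by_cases hr : r = 0 <;> simp [hr, h]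

/-- **The inverse of `L_t`**: `(∑ (-tN₂)ʲ) D⁻¹ (1 - tN₁)`. [cite: HusemollerFibreBundles1994, Ch. 11 Notation 3.1] -/
def LtInv (a : Fin (m + 1) → Matrix ι ι S) (z t : S) (pinv : Matrix ι ι S) : Blk m ι S :=
  N2Inv z t * DmatInv pinv * (1 - t • N1 a z)

/-- Auxiliary identity for the linearisation block algebra. [folklore] -/
theorem Lt_mul_LtInv (a : Fin (m + 1) → Matrix ι ι S) (z t : S) {pinv : Matrix ι ι S} (h : polyEval a z * pinv = 1) :
    Lt a z t * LtInv a z t pinv = 1 := by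
  rw [Lt, LtInv]
  calc (1 + t • N1 a z) * Dmat a z * (1 + t • N2 z) * (N2Inv z t * DmatInv pinv * (1 - t • N1 a z))
      = (1 + t • N1 a z) * (Dmat a z * ((1 + t • N2 z) * N2Inv z t) * DmatInv pinv) * (1 - t • N1 a z) := by
        simp only [Matrix.mul_assoc]
    _ = 1 := by rw [one_add_N2_mul_N2Inv, Matrix.mul_one, Dmat_mul_DmatInv a z h, Matrix.mul_one, one_add_N1_mul]

/-- Auxiliary identity for the linearisation block algebra. [folklore] -/
theorem LtInv_mul_Lt (a : Fin (m + 1) → Matrix ι ι S) (z t : S) {pinv : Matrix ι ι S} (h : pinv * polyEval a z = 1) :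
    LtInv a z t pinv * Lt a z t = 1 := by
  rw [Lt, LtInv]
  calc N2Inv z t * DmatInv pinv * (1 - t • N1 a z) * ((1 + t • N1 a z) * Dmat a z * (1 + t • N2 z))
      = N2Inv z t * (DmatInv pinv * ((1 - t • N1 a z) * (1 + t • N1 a z)) * Dmat a z) * (1 + t • N2 z) := by
        simp only [Matrix.mul_assoc]
    _ = 1 := by rw [one_sub_N1_mul, Matrix.mul_one, DmatInv_mul_Dmat a z h, Matrix.mul_one, N2Inv_mul_one_add_N2]

/-! ### Linearity in `z` and change of rings -/

/-- The constant part `A` of `Lᵐ(p) = A + z B`. [cite: HusemollerFibreBundles1994, Ch. 11 Notation 3.1] -/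
def LmatA (a : Fin (m + 1) → Matrix ι ι S) : Blk m ι S :=
  Matrix.of fun r c ↦ if r = 0 then a c else if c = r then 1 else 0

/-- The `z`-part `B` of `Lᵐ(p) = A + z B` (`-1` on the subdiagonal). [cite: HusemollerFibreBundles1994, Ch. 11 Notation 3.1] -/
def LmatB (m : ℕ) (ι : Type*) (S : Type*) [CommRing S] [DecidableEq ι] : Blk m ι S :=
  Matrix.of fun r c ↦ if r ≠ 0 ∧ (c : ℕ) + 1 = r then -1 else 0

omit [Fintype ι] in
/-- **`Lᵐ(p)` is linear in `z`.** [cite: HusemollerFibreBundles1994, Ch. 11 Notation 3.1] -/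
theorem Lmat_eq (a : Fin (m + 1) → Matrix ι ι S) (z : S) : Lmat a z = LmatA a + z • LmatB m ι S := by
  ext r c : 1
  simp only [Lmat, LmatA, LmatB, Matrix.add_apply, Matrix.smul_apply, Matrix.of_apply]
  by_cases hr : r = 0
  · simp [hr]
  · by_cases hcr : c = r
    · subst hcr
      simp [hr]
    · by_cases h2 : (c : ℕ) + 1 = r <;> simp [hr, hcr, h2]

variable {S' : Type*} [CommRing S']

omit [Fintype ι] [DecidableEq ι] in
/-- Auxiliary identity for the linearisation block algebra. [folklore] -/
theorem polyEval_map (a : Fin (m + 1) → Matrix ι ι S) (z : S) (f : S →+* S') :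
    (polyEval a z).map f = polyEval (fun k ↦ (a k).map f) (f z) := by
  ext i j
  simp [polyEval, Matrix.sum_apply]

omit [Fintype ι] [DecidableEq ι] in
/-- Auxiliary identity for the linearisation block algebra. [folklore] -/
theorem polyTail_map (a : Fin (m + 1) → Matrix ι ι S) (z : S) (f : S →+* S') (r : Fin (m + 1)) :
    (polyTail a z r).map f = polyTail (fun k ↦ (a k).map f) (f z) r := by
  ext i j
  simp only [polyTail, Matrix.map_apply, Matrix.sum_apply, map_sum]
  refine Finset.sum_congr rfl fun k _ ↦ ?_
  split_ifs <;> simp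

/-- Auxiliary identity for the linearisation block algebra. [folklore] -/
theorem N1_map (a : Fin (m + 1) → Matrix ι ι S) (z : S) (f : S →+* S') :
    (N1 a z).map f.mapMatrix = N1 (fun k ↦ (a k).map f) (f z) := by
  ext r c : 1
  simp only [N1, Matrix.map_apply, Matrix.of_apply]
  split_ifs
  · exact polyTail_map a z f c
  · exact Matrix.map_zero _ (map_zero f)

/-- Auxiliary identity for the linearisation block algebra. [folklore] -/
theorem N2_map (z : S) (f : S →+* S') : (N2 z : Blk m ι S).map f.mapMatrix = N2 (f z) := by
  ext r c : 1
  simp only [N2, Matrix.map_apply, Matrix.of_apply]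
  split_ifs
  · rw [RingHom.mapMatrix_apply, Matrix.map_neg _ (map_neg f), Matrix.map_smul' _ _ _ (map_mul f),
      Matrix.map_one _ (map_zero f) (map_one f)]
  · exact Matrix.map_zero _ (map_zero f)

/-- Auxiliary identity for the linearisation block algebra. [folklore] -/
theorem Dmat_map (a : Fin (m + 1) → Matrix ι ι S) (z : S) (f : S →+* S') :
    (Dmat a z).map f.mapMatrix = Dmat (fun k ↦ (a k).map f) (f z) := by
  rw [Dmat, Dmat, Matrix.diagonal_map (map_zero _)]
  congr 1; ext r : 1
  change f.mapMatrix _ = _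
  split_ifs
  · exact polyEval_map a z f
  · exact Matrix.map_one _ (map_zero f) (map_one f)

/-- Scalars from `S` pass through the block-entrywise map. [folklore] -/
theorem blk_map_smul (t : S) (M : Blk m ι S) (f : S →+* S') : (t • M).map f.mapMatrix = f t • M.map f.mapMatrix := by
  ext r c : 1
  simp only [Matrix.map_apply, Matrix.smul_apply, RingHom.mapMatrix_apply]
  exact Matrix.map_smul' _ _ _ (map_mul f)

/-- **`L_t` is compatible with change of rings** (base change / restriction to slices). [folklore] -/
theorem Lt_map (a : Fin (m + 1) → Matrix ι ι S) (z t : S) (f : S →+* S') :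
    (Lt a z t).map f.mapMatrix = Lt (fun k ↦ (a k).map f) (f z) (f t) := by
  rw [Lt, Lt, Matrix.map_mul, Matrix.map_mul, Matrix.map_add _ (map_add _), Matrix.map_add _ (map_add _),
    Matrix.map_one _ (map_zero _) (map_one _), blk_map_smul, blk_map_smul, N1_map, N2_map, Dmat_map]

/-- `L_t` at the entry level (`Matrix.comp`) is compatible with change of rings. [folklore] -/
theorem comp_Lt_map (a : Fin (m + 1) → Matrix ι ι S) (z t : S) (f : S →+* S') :
    (Matrix.comp _ _ _ _ _ (Lt a z t)).map f = Matrix.comp _ _ _ _ _ (Lt (fun k ↦ (a k).map f) (f z) (f t)) := by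
  rw [← Lt_map, ← Matrix.comp_map_map]; rfl

end Literature.AlgebraicTopology.KTheory.Linearization
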